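import Summits.ResolutionOfSingularities.ResolutionOfSingularities.Theorems.DescentDescentPerfectToAllResidualWitness
import Mathlib.SetTheory.Cardinal.Subfield
import HarnessLib

/-!
# `DescentPerfectToAll` (stmt-ResolutionOfSingularities-0549): a COUNTABLE inhabitant of the residual class

Route `ResolutionOfSingularities/Descent`, crux `DescentPerfectToAll`. Helper (OURS; not a statement of any
manuscript; `--supports` the crux, does not close it).

`descentPerfectToAll_iff_residual` (`DescentDescentPerfectToAllExhaustion.lean`) restates the crux as:
`PerfectRes p` implies resolution over every COUNTABLE field of characteristic `p` that is not EFT-separably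
exhausted. `DescentDescentPerfectToAllResidualWitness.lean` shows that the uncountable field `𝔽_p((X))` is
not EFT-separably exhausted; this file shows that the COUNTABLE residual class is inhabited too, so that the
equivalence does not settle the crux vacuously:

* `card_le_of_linearIndependent_of_span_eq_top` — linear algebra: a space spanned by `m` vectors has no
  linearly independent family of more than `m` members;
* `exists_countable_digitClosed_subfield_laurentSeries` — every finite `s ⊆ 𝔽_p((X))` lies in a COUNTABLE
  subfield `K₀ ∋ X` closed under extracting `p`-digits (`f = ∑_{e<p} X^e r_e^p` with all `r_e ∈ K₀`): the
  union of the tower `F₀ = 𝔽_p(s, X)`, `F_{n+1} = F_n(p-digit roots of all elements of F_n)`;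
* `exists_countable_field_not_exhaustedByEssFiniteType` — **a countable field of characteristic `p` that
  is not EFT-separably exhausted**: such a `K₀` containing two algebraically independent Laurent series
  has `[K₀ : K₀^p] ≤ p`, trivial perfect subfields (it embeds in `𝔽_p((X))`) and transcendence degree
  `≥ 2`, so `not_exhaustedByEssFiniteType_of_pRank_le_one` applies.

[cite: Matsumura1987, §26 pp. 201–203; EGAIV2, Prop. 6.7.4] [folklore]
-/

noncomputable section

set_option linter.dupNamespace false -- mandated namespace of this single-conjunct summit

open scoped LaurentSeries

namespace Summit.ResolutionOfSingularities.ResolutionOfSingularities.Theorems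

/-- Linear algebra: if `M` is spanned by `w : Fin m → M`, every linearly independent `v : Fin n → M` has
`n ≤ m`. [folklore] -/
theorem card_le_of_linearIndependent_of_span_eq_top {R M : Type*} [DivisionRing R] [AddCommGroup M]
    [Module R M] {m : ℕ} (w : Fin m → M) (hw : Submodule.span R (Set.range w) = ⊤) {n : ℕ}
    (v : Fin n → M) (hv : LinearIndependent R v) : n ≤ m := by
  haveI : Module.Finite R M := by
    rw [Module.finite_def, ← hw]
    exact Submodule.fg_span (Set.finite_range _)
  calc n = Fintype.card (Fin n) := (Fintype.card_fin n).symm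
    _ ≤ Module.finrank R M := hv.fintype_card_le_finrank
    _ ≤ m := by
      have h := finrank_range_le_card (R := R) w
      rw [Set.finrank, hw, finrank_top, Fintype.card_fin] at h
      exact h

variable (p : ℕ) [Fact p.Prime]

/-- **A countable digit-closed subfield of `𝔽_p((X))` through any finite set**: for every finite
`s ⊆ 𝔽_p((X))` there is a countable subfield `K₀ ∋ X` containing `s` such that every `f ∈ K₀` is
`∑_{e<p} X^e r_e^p` with all `r_e ∈ K₀` (the union of the tower `F₀ = 𝔽_p(s, X)`,
`F_{n+1} = F_n(p-digit roots of the elements of F_n)`; each step is countable). [folklore] -/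
theorem exists_countable_digitClosed_subfield_laurentSeries (s : Finset ((ZMod p)⸨X⸩)) :
    ∃ K₀ : Subfield ((ZMod p)⸨X⸩), Countable K₀ ∧ (↑s : Set ((ZMod p)⸨X⸩)) ⊆ K₀ ∧
      HahnSeries.single (1 : ℤ) (1 : ZMod p) ∈ K₀ ∧
      ∀ f ∈ K₀, ∃ r : Fin p → (ZMod p)⸨X⸩, (∀ e, r e ∈ K₀) ∧
        f = ∑ e : Fin p, (HahnSeries.single (1 : ℤ) (1 : ZMod p)) ^ (e : ℕ) * (r e) ^ p := by
  classical
  haveI : CharP ((ZMod p)⸨X⸩) p :=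
    charP_of_injective_algebraMap (algebraMap (ZMod p) ((ZMod p)⸨X⸩)).injective p
  -- `p`-digit roots of every Laurent series
  have hdig : ∀ f : (ZMod p)⸨X⸩, ∃ r : Fin p → (ZMod p)⸨X⸩,
      f = ∑ e : Fin p, (HahnSeries.single (1 : ℤ) (1 : ZMod p)) ^ (e : ℕ) * (r e) ^ p := by
    intro f
    obtain ⟨c, hc⟩ := Submodule.mem_span_range_iff_exists_fun (R := (frobenius ((ZMod p)⸨X⸩) p).fieldRange)
      |>.mp (laurentSeries_mem_span_frobenius p f)
    have hr : ∀ e, ∃ r : (ZMod p)⸨X⸩, r ^ p = (c e : (ZMod p)⸨X⸩) := fun e =>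
      RingHom.mem_fieldRange.mp (c e).2
    choose r hr using hr
    refine ⟨r, ?_⟩
    rw [← hc]
    exact Finset.sum_congr rfl fun e _ => by rw [Subfield.smul_def, smul_eq_mul, hr, mul_comm]
  choose r hr using hdig
  -- the tower
  obtain ⟨F, hF0, hFsucc⟩ : ∃ F : ℕ → Subfield ((ZMod p)⸨X⸩),
      F 0 = Subfield.closure ((↑s : Set ((ZMod p)⸨X⸩)) ∪ {HahnSeries.single (1 : ℤ) 1}) ∧
      ∀ n, F (n + 1) = Subfield.closure ((F n : Set ((ZMod p)⸨X⸩)) ∪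
        Set.range (fun q : F n × Fin p => r (q.1 : (ZMod p)⸨X⸩) q.2)) :=
    ⟨fun n => (fun Fn : Subfield ((ZMod p)⸨X⸩) => Subfield.closure ((Fn : Set ((ZMod p)⸨X⸩)) ∪
        Set.range (fun q : Fn × Fin p => r (q.1 : (ZMod p)⸨X⸩) q.2)))^[n]
          (Subfield.closure ((↑s : Set ((ZMod p)⸨X⸩)) ∪ {HahnSeries.single (1 : ℤ) 1})),
      Function.iterate_zero_apply _ _, fun n => Function.iterate_succ_apply' _ n _⟩
  have hle : ∀ n, F n ≤ F (n + 1) := fun n x hx => by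
    rw [hFsucc]
    exact Subfield.subset_closure (Set.mem_union_left _ hx)
  have hmono : Monotone F := monotone_nat_of_le_succ hle
  -- countability of the levels
  have hcount : ∀ n, Countable ↥(F n) := by
    intro n
    induction n with
    | zero =>
      rw [hF0, ← Cardinal.mk_le_aleph0_iff]
      refine (Subfield.cardinalMk_closure_le_max _).trans (max_le ?_ le_rfl)
      exact Cardinal.mk_le_aleph0_iff.mpr (Set.Finite.countable (by simp)).to_subtype
    | succ n ih =>
      rw [hFsucc, ← Cardinal.mk_le_aleph0_iff]
      refine (Subfield.cardinalMk_closure_le_max _).trans (max_le ?_ le_rfl)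
      refine Cardinal.mk_le_aleph0_iff.mpr (Set.Countable.to_subtype ?_)
      have h1 : ((F n : Subfield ((ZMod p)⸨X⸩)) : Set ((ZMod p)⸨X⸩)).Countable :=
        (Set.countable_coe_iff (s := ((F n : Subfield ((ZMod p)⸨X⸩)) : Set ((ZMod p)⸨X⸩)))).mp ih
      exact h1.union (Set.countable_range _)
  -- the union
  have hmemK₀ : ∀ y, y ∈ (⨆ n, F n) ↔ ∃ n, y ∈ F n := fun y =>
    Subfield.mem_iSup_of_directed hmono.directed_le
  refine ⟨⨆ n, F n, ?_, ?_, ?_, ?_⟩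
  · have hU : (((⨆ n, F n : Subfield ((ZMod p)⸨X⸩))) : Set ((ZMod p)⸨X⸩)) =
        ⋃ n, (F n : Set ((ZMod p)⸨X⸩)) :=
      Subfield.coe_iSup_of_directed hmono.directed_le
    refine (Set.countable_coe_iff (s := (((⨆ n, F n : Subfield ((ZMod p)⸨X⸩))) : Set ((ZMod p)⸨X⸩)))).mpr ?_
    rw [hU]
    exact Set.countable_iUnion fun n =>
      (Set.countable_coe_iff (s := ((F n : Subfield ((ZMod p)⸨X⸩)) : Set ((ZMod p)⸨X⸩)))).mp (hcount n)
  · intro y hy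
    exact (hmemK₀ y).mpr ⟨0, by rw [hF0]; exact Subfield.subset_closure (Set.mem_union_left _ hy)⟩
  · exact (hmemK₀ _).mpr ⟨0, by rw [hF0]; exact Subfield.subset_closure (Set.mem_union_right _ rfl)⟩
  · intro f hf
    obtain ⟨n, hn⟩ := (hmemK₀ f).mp hf
    refine ⟨r f, fun e => (hmemK₀ _).mpr ⟨n + 1, ?_⟩, hr f⟩
    rw [hFsucc]
    exact Subfield.subset_closure (Set.mem_union_right _ ⟨(⟨f, hn⟩, e), rfl⟩)

/-- **A countable field of characteristic `p` that is not EFT-separably exhausted** — so the COUNTABLE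
residual class of `descentPerfectToAll_iff_residual` is inhabited and that equivalence does not settle the
crux vacuously: a countable digit-closed subfield `K₀ ≤ 𝔽_p((X))` containing two algebraically independent
Laurent series has `[K₀ : K₀^p] ≤ p`, trivial perfect subfields, and transcendence degree `≥ 2`
(`not_exhaustedByEssFiniteType_of_pRank_le_one`). [cite: Matsumura1987, Thm. 26.4 and Thm. 26.5;
EGAIV2, Prop. 6.7.4] -/
theorem exists_countable_field_not_exhaustedByEssFiniteType :
    ∃ (k : Type) (_ : Field k) (_ : CharP k p), Countable k ∧ ¬ ∀ s : Finset k, ∃ (k₀ : Type)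
      (_ : Field k₀) (_ : PerfectField k₀) (E : Subfield k) (_ : Algebra k₀ E), Algebra.EssFiniteType k₀ E ∧
        (↑s : Set k) ⊆ E ∧
        ∀ u : Finset k, LinearIndepOn E _root_.id (↑u : Set k) →
          LinearIndepOn E (fun y : k => y ^ p) (↑u : Set k) := by
  classical
  haveI : CharP ((ZMod p)⸨X⸩) p :=
    charP_of_injective_algebraMap (algebraMap (ZMod p) ((ZMod p)⸨X⸩)).injective p
  obtain ⟨u₁, u₂, hind⟩ := exists_algebraicIndependent_pair_laurentSeries p
  obtain ⟨K₀, hK₀c, hsub, hX, hdig⟩ := exists_countable_digitClosed_subfield_laurentSeries p {u₁, u₂}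
  haveI : CharP K₀ p := K₀.subtype.charP Subtype.val_injective p
  letI : Algebra (ZMod p) K₀ := (ZMod.castHom (dvd_refl p) K₀).toAlgebra
  have hu₁ : u₁ ∈ K₀ := hsub (by simp)
  have hu₂ : u₂ ∈ K₀ := hsub (by simp)
  have hcomp : K₀.subtype.comp (algebraMap (ZMod p) K₀) = algebraMap (ZMod p) ((ZMod p)⸨X⸩) :=
    Subsingleton.elim _ _
  refine ⟨K₀, inferInstance, inferInstance, hK₀c, ?_⟩
  -- (c) the algebraically independent pair, lifted to `K₀`
  set xK : Option (Fin 1) → K₀ := fun o => o.elim ⟨u₂, hu₂⟩ ![⟨u₁, hu₁⟩] with hxK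
  have hxKval : (fun o => K₀.subtype (xK o)) = fun o : Option (Fin 1) => o.elim u₂ ![u₁] := by
    funext o
    rcases o with _ | i
    · rfl
    · simp only [hxK, Option.elim_some, Matrix.cons_val_fin_one]
      rfl
  have hφ0 : ∀ a : ZMod p, ∃ c : ZMod p,
      K₀.subtype (algebraMap (ZMod p) K₀ a) = algebraMap (ZMod p) ((ZMod p)⸨X⸩) c :=
    fun a => ⟨a, by rw [← RingHom.comp_apply, hcomp]⟩
  have hindK : AlgebraicIndependent (ZMod p) xK :=
    algebraicIndependent_of_ringHom_eq p K₀.subtype hφ0 xK (hxKval ▸ hind)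
  refine not_exhaustedByEssFiniteType_of_pRank_le_one p K₀ ?_ ?_ xK hindK (by simp)
  · -- (a) `[K₀ : K₀^p] ≤ p`: `K₀` is spanned over `K₀^p` by the powers of `X`
    intro n v hv
    refine card_le_of_linearIndependent_of_span_eq_top
      (fun e : Fin p => (⟨HahnSeries.single (1 : ℤ) (1 : ZMod p), hX⟩ : K₀) ^ (e : ℕ)) ?_ v hv
    rw [Submodule.eq_top_iff']
    intro f
    obtain ⟨r, hrK, hf⟩ := hdig f f.2
    have hfe : f = ∑ e : Fin p,
        (⟨HahnSeries.single (1 : ℤ) (1 : ZMod p), hX⟩ : K₀) ^ (e : ℕ) * (⟨r e, hrK e⟩ : K₀) ^ p := by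
      apply Subtype.ext
      push_cast
      exact hf
    rw [hfe]
    refine Submodule.sum_mem _ fun e _ => ?_
    have hmem : (⟨r e, hrK e⟩ : K₀) ^ p ∈ (frobenius K₀ p).fieldRange :=
      RingHom.mem_fieldRange.mpr ⟨⟨r e, hrK e⟩, rfl⟩
    have hterm : (⟨HahnSeries.single (1 : ℤ) (1 : ZMod p), hX⟩ : K₀) ^ (e : ℕ) * (⟨r e, hrK e⟩ : K₀) ^ p =
        (⟨_, hmem⟩ : (frobenius K₀ p).fieldRange) •
          (⟨HahnSeries.single (1 : ℤ) (1 : ZMod p), hX⟩ : K₀) ^ (e : ℕ) := by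
      rw [Subfield.smul_def, smul_eq_mul, mul_comm]
    rw [hterm]
    exact Submodule.smul_mem _ _ (Submodule.subset_span ⟨e, rfl⟩)
  · -- (b) perfect subfields of `K₀ ≤ 𝔽_p((X))` are the prime field
    intro k₀ _ _ φ a
    refine ⟨(K₀.subtype (φ a)).coeff 0, Subtype.ext ?_⟩
    have h1 := laurentSeries_ringHom_eq_C_of_perfectField p (K₀.subtype.comp φ) a
    rw [RingHom.comp_apply] at h1
    have h2 : ((algebraMap (ZMod p) K₀ ((K₀.subtype (φ a)).coeff 0) : K₀) : (ZMod p)⸨X⸩) =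
        HahnSeries.C ((K₀.subtype (φ a)).coeff 0) := by
      rw [show HahnSeries.C = algebraMap (ZMod p) ((ZMod p)⸨X⸩) from Subsingleton.elim _ _, ← hcomp]
      rfl
    rw [h2]
    exact h1

end Summit.ResolutionOfSingularities.ResolutionOfSingularities.Theorems

end
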